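import Literature.Computability.Cryptography.UOWHF
import HarnessLib

/-!
# Length-restricted universal one-way hash functions (Goldreich 2004, Definition 6.4.19)

Topic `Literature/Computability/Cryptography`. The companion notion to `HashCollection.IsUOWHF`
(`UOWHF.lean`, Def. 6.4.18): a **`(d, r)`-UOWHF** is a collection `{h_s : {0,1}^{d(|s|)} → {0,1}^{r(|s|)}}`
with indices of length `|s| = n` on the range of `I(1ⁿ)`, efficient evaluation, and hardness to form
designated collisions *inside the length-`d(|s|)` domain* (Goldreich 2004, §6.4.3.2, Def. 6.4.19). It is
the interface through which "one-way functions ⇒ UOWHF" passes: the hard step is a `(d, d−1)`-UOWHF from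
any one-way function (the book's Thm. 6.4.29, proved there only from one-way permutations, Prop. 6.4.21;
from arbitrary one-way functions by Rompel 1990 / Haitner–Holenstein–Reingold–Vadhan–Wee 2020, the
`InaccessibleEntropy*.lean` files of this directory), after which Steps II–IV of §6.4.3.2 (Constructions
6.4.22, 6.4.24, 6.4.26) give full-fledged UOWHFs.

* `IsRestrictedCollision H d (s, x₀, x)` — `|x₀| = |x| = d(|s|)`, `h_s(x) = h_s(x₀)`, `x ≠ x₀` (a designated
  collision INSIDE the domain; targets or answers of the wrong length never count, which is Def. 6.4.19's
  restriction of `A₀` to maps into `{0,1}^{d(|s|)}` built into the event);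
* `rtcrProb H d q A₀ A n` — its probability in the three-stage experiment `tcrExpPMF` of `UOWHF.lean`;
  `rtcrProb_nonneg`, `rtcrProb_le_one`, `rtcrProb_le_tcrProb`;
* `toReal_tcrExpPMF_eq_uniformAvg` — the experiment's probability of ANY event as a triple finite average
  over target coins, sampler coins and adversary coins (generalising `tcrProb_eq_uniformAvg`), and its
  instance `rtcrProb_eq_uniformAvg`;
* `IsRestrictedUOWHF H d r` — **Definition 6.4.19**.

No existence statement and no machines here. Design: as in `UOWHF.lean` the residual adversary receives
`(1ⁿ, s, r)`; condition 1 is `|s| = n` for all large `n` (the book's "more stringent condition", footnote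
34); the range condition is asked only on the domain `{0,1}^{d(|s|)}`.

## References

* O. Goldreich, *Foundations of Cryptography II: Basic Applications*, CUP 2004, §6.4.3.2, Def. 6.4.19 (PDF
  p. 256 of the held copy), Steps I–IV, Thm. 6.4.28–6.4.29.
* M. Naor, M. Yung, *Universal one-way hash functions and their cryptographic applications*, STOC 1989.
* J. Rompel, *One-way functions are necessary and sufficient for secure signatures*, STOC 1990.
-/

namespace Literature.Computability.Cryptography

namespace HashCollection

open Filter Asymptotics _root_.Computability Complexity Finset Polynomial

/-- A *designated collision inside the length-`d(|s|)` domain*: outcome `(s, x₀, x)` with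
`|x₀| = |x| = d(|s|)`, `h_s(x) = h_s(x₀)` and `x ≠ x₀`. [cite: Goldreich2004, Def. 6.4.19 (3)] -/
def IsRestrictedCollision (H : HashCollection) (d : ℕ → ℕ) (t : List Bool × List Bool × List Bool) : Prop :=
  t.2.1.length = d t.1.length ∧ t.2.2.length = d t.1.length ∧ H.hash t.1 t.2.2 = H.hash t.1 t.2.1 ∧ t.2.2 ≠ t.2.1

/-- A restricted designated collision is in particular a designated collision. [cite: Goldreich2004, Def. 6.4.19] -/
theorem IsRestrictedCollision.isDesignatedCollision {H : HashCollection} {d : ℕ → ℕ}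
    {t : List Bool × List Bool × List Bool} (h : H.IsRestrictedCollision d t) : H.IsDesignatedCollision t :=
  ⟨h.2.2.1, h.2.2.2⟩

/-- `H.rtcrProb d q A₀ A n`: the probability that the residual adversary forms a designated collision inside
the domain `{0,1}^{d(|s|)}` with the target of `A₀`. [cite: Goldreich2004, Def. 6.4.19 (3) with Eq. (6.7)] -/
noncomputable def rtcrProb (H : HashCollection) (d : ℕ → ℕ) (q : ℕ → ℕ) (A₀ : List Bool → List Bool)
    (A : RandAlg (List Bool) (List Bool)) (n : ℕ) : ℝ :=
  ((H.tcrExpPMF q A₀ A n).toOuterMeasure {t | H.IsRestrictedCollision d t}).toReal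

/-- Restricted designated-collision probabilities are nonnegative. [cite: Goldreich2004, Def. 6.4.19] -/
theorem rtcrProb_nonneg (H : HashCollection) (d : ℕ → ℕ) (q : ℕ → ℕ) (A₀ : List Bool → List Bool)
    (A : RandAlg (List Bool) (List Bool)) (n : ℕ) : 0 ≤ H.rtcrProb d q A₀ A n :=
  ENNReal.toReal_nonneg

/-- Restricted designated-collision probabilities are at most `1`. [cite: Goldreich2004, Def. 6.4.19] -/
theorem rtcrProb_le_one (H : HashCollection) (d : ℕ → ℕ) (q : ℕ → ℕ) (A₀ : List Bool → List Bool)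
    (A : RandAlg (List Bool) (List Bool)) (n : ℕ) : H.rtcrProb d q A₀ A n ≤ 1 :=
  ENNReal.toReal_le_of_le_ofReal zero_le_one
    (by rw [ENNReal.ofReal_one]; exact pmf_toOuterMeasure_apply_le_one _ _)

/-- `rtcrProb ≤ tcrProb` (the restricted event is smaller). [cite: Goldreich2004, Def. 6.4.18–6.4.19] -/
theorem rtcrProb_le_tcrProb (H : HashCollection) (d : ℕ → ℕ) (q : ℕ → ℕ) (A₀ : List Bool → List Bool)
    (A : RandAlg (List Bool) (List Bool)) (n : ℕ) : H.rtcrProb d q A₀ A n ≤ H.tcrProb q A₀ A n := by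
  unfold rtcrProb tcrProb
  refine ENNReal.toReal_mono ?_ ((H.tcrExpPMF q A₀ A n).toOuterMeasure.mono fun t ht => ?_)
  · exact ne_top_of_le_ne_top ENNReal.one_ne_top (pmf_toOuterMeasure_apply_le_one _ _)
  · exact IsRestrictedCollision.isDesignatedCollision ht

/-! ### The experiment as a finite average, for an arbitrary event -/

/-- A uniform average as a sum of normalised terms (local copy of `uniformAvg_eq_sum_div`). [folklore] -/
private theorem uniformAvg_eq_sum_div' (m : ℕ) (g : List Bool → ℝ) :
    uniformAvg m g = ∑ v : List.Vector Bool m, g v.toList / 2 ^ m := by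
  rw [uniformAvg, Finset.sum_div]

/-- Uniform averages only see `m`-bit strings (local copy of `uniformAvg_congr`). [folklore] -/
private theorem uniformAvg_congr' {m : ℕ} {f g : List Bool → ℝ} (h : ∀ x : List Bool, x.length = m → f x = g x) :
    uniformAvg m f = uniformAvg m g := by
  unfold uniformAvg
  congr 1
  exact Finset.sum_congr rfl fun x _ => h _ (by simp)

/-- **The three-stage experiment evaluates any event as a triple finite average** over the target coins
`r ∈ {0,1}^{q(n)}`, the sampler's coins and the residual adversary's coins, of the event's indicator on
`(s, A₀ r, A(1ⁿ, s, r))` (generalising `tcrProb_eq_uniformAvg`, same proof).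
[cite: Goldreich2004, Def. 6.4.18 (the probability space of Eq. (6.7))] -/
theorem toReal_tcrExpPMF_eq_uniformAvg (H : HashCollection) (q : ℕ → ℕ) (A₀ : List Bool → List Bool)
    (A : RandAlg (List Bool) (List Bool)) (n : ℕ) (E : Set (List Bool × List Bool × List Bool))
    [DecidablePred (· ∈ E)] :
    ((H.tcrExpPMF q A₀ A n).toOuterMeasure E).toReal =
      uniformAvg (q n) fun r =>
        uniformAvg (H.index.coinLen (unaryEncodeNat n).length) fun rI =>
          uniformAvg (A.coinLen (boolPair (unaryEncodeNat n) (boolPair (H.index.run n rI) r)).length) fun rA =>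
            if (H.index.run n rI, A₀ r, A.run (boolPair (unaryEncodeNat n) (boolPair (H.index.run n rI) r)) rA) ∈ E
            then 1 else 0 := by
  classical
  set L := H.index.coinLen (unaryEncodeNat n).length with hL
  set inp : List Bool → List Bool → List Bool := fun s r => boolPair (unaryEncodeNat n) (boolPair s r) with hinp
  -- innermost: the adversary's coins
  have hA : ∀ s r : List Bool, (((A.outputPMF id (inp s r)).map fun x => (s, A₀ r, x)).toOuterMeasure E).toReal =
      uniformAvg (A.coinLen (inp s r).length) fun rA => if (s, A₀ r, A.run (inp s r) rA) ∈ E then 1 else 0 := by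
    intro s r
    rw [RandAlg.outputPMF, PMF.map_comp, toReal_toOuterMeasure_map_uniform]
    refine uniformAvg_congr' fun rA hrA => ?_
    simp only [Function.comp_apply, id]
    by_cases hc : (s, A₀ r, A.run (inp s r) rA) ∈ E
    · rw [if_pos hc, if_pos ⟨⟨rA, hrA⟩, rfl, hc⟩]
    · rw [if_neg hc, if_neg]
      rintro ⟨v, hv, h⟩
      rw [hv] at h
      exact hc h
  -- middle: the sampler's coins
  have hI : ∀ r : List Bool, (((H.indexPMF n).bind fun s => (A.outputPMF id (inp s r)).map fun x => (s, A₀ r, x)).toOuterMeasure E).toReal =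
      uniformAvg L fun rI => uniformAvg (A.coinLen (inp (H.index.run n rI) r).length) fun rA =>
        if (H.index.run n rI, A₀ r, A.run (inp (H.index.run n rI) r) rA) ∈ E then 1 else 0 := by
    intro r
    rw [indexPMF, RandAlg.outputPMF, PMF.bind_map, PMF.toOuterMeasure_bind_apply, tsum_fintype,
      ENNReal.toReal_sum (fun v _ => ?_), uniformAvg_eq_sum_div']
    · refine Finset.sum_congr rfl fun v _ => ?_
      rw [ENNReal.toReal_mul, Function.comp_apply, hA, PMF.uniformOfFintype_apply, card_vector, Fintype.card_bool,
        ENNReal.toReal_inv]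
      simp only [ENNReal.toReal_pow, ENNReal.toReal_ofNat, Nat.cast_pow, Nat.cast_ofNat]
      rw [div_eq_inv_mul]
    · refine ENNReal.mul_ne_top ?_ ?_
      · rw [PMF.uniformOfFintype_apply]
        exact ENNReal.inv_ne_top.2 (by exact_mod_cast Fintype.card_ne_zero)
      · exact ne_top_of_le_ne_top ENNReal.one_ne_top (pmf_toOuterMeasure_apply_le_one _ _)
  -- outermost: the target coins
  rw [tcrExpPMF, PMF.toOuterMeasure_bind_apply, tsum_fintype, ENNReal.toReal_sum (fun v _ => ?_), uniformAvg_eq_sum_div']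
  · refine Finset.sum_congr rfl fun v _ => ?_
    rw [ENNReal.toReal_mul, hI, PMF.uniformOfFintype_apply, card_vector, Fintype.card_bool, ENNReal.toReal_inv]
    simp only [ENNReal.toReal_pow, ENNReal.toReal_ofNat, Nat.cast_pow, Nat.cast_ofNat]
    rw [div_eq_inv_mul]
  · refine ENNReal.mul_ne_top ?_ ?_
    · rw [PMF.uniformOfFintype_apply]
      exact ENNReal.inv_ne_top.2 (by exact_mod_cast Fintype.card_ne_zero)
    · exact ne_top_of_le_ne_top ENNReal.one_ne_top (pmf_toOuterMeasure_apply_le_one _ _)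

/-- Decidability of the restricted-collision predicate. [folklore] -/
instance decidableIsRestrictedCollision (H : HashCollection) (d : ℕ → ℕ) (t : List Bool × List Bool × List Bool) :
    Decidable (H.IsRestrictedCollision d t) := by
  unfold IsRestrictedCollision; infer_instance

/-- Decidability of the restricted-collision event. [folklore] -/
instance (H : HashCollection) (d : ℕ → ℕ) : DecidablePred (· ∈ {t | H.IsRestrictedCollision d t}) :=
  fun t => by simp only [Set.mem_setOf_eq]; infer_instance

/-- **`rtcrProb` as a triple finite average** of the restricted-collision indicator.
[cite: Goldreich2004, Def. 6.4.19 (3)] -/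
theorem rtcrProb_eq_uniformAvg (H : HashCollection) (d : ℕ → ℕ) (q : ℕ → ℕ) (A₀ : List Bool → List Bool)
    (A : RandAlg (List Bool) (List Bool)) (n : ℕ) :
    H.rtcrProb d q A₀ A n =
      uniformAvg (q n) fun r =>
        uniformAvg (H.index.coinLen (unaryEncodeNat n).length) fun rI =>
          uniformAvg (A.coinLen (boolPair (unaryEncodeNat n) (boolPair (H.index.run n rI) r)).length) fun rA =>
            if H.IsRestrictedCollision d
                (H.index.run n rI, A₀ r, A.run (boolPair (unaryEncodeNat n) (boolPair (H.index.run n rI) r)) rA)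
            then 1 else 0 := by
  rw [rtcrProb, toReal_tcrExpPMF_eq_uniformAvg]
  rfl

/-- **Definition 6.4.19** — `H.IsRestrictedUOWHF d r`: `(I, {h_s})` is a collection of `(d, r)`-UOWHFs:
efficient (PPT `I`, polynomial-time evaluation); on the domain `{0,1}^{d(|s|)}` the values have length `r(|s|)`;
for all large `n` every index in the range of `I(1ⁿ)` has length `n`; and for every polynomial `q`, every
deterministic polynomial-time `A₀` and every PPT `A`, the probability of a designated collision inside the
domain is negligible. [cite: Goldreich2004, Def. 6.4.19] -/
def IsRestrictedUOWHF (H : HashCollection) (d r : ℕ → ℕ) : Prop :=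
  H.IsEfficient ∧
    (∀ s x : List Bool, x.length = d s.length → (H.hash s x).length = r s.length) ∧
    (∀ᶠ n in atTop, ∀ s ∈ (H.indexPMF n).support, s.length = n) ∧
    ∀ q : Polynomial ℕ, ∀ A₀ : List Bool → List Bool, A₀ ∈ FP →
      ∀ A : RandAlg (List Bool) (List Bool), IsPPT A id →
        SuperpolynomialDecay atTop (fun n : ℕ => (n : ℝ)) (H.rtcrProb d (fun n => q.eval n) A₀ A)

/-- The components of Def. 6.4.19: efficiency. [cite: Goldreich2004, Def. 6.4.19 (2)] -/
theorem IsRestrictedUOWHF.isEfficient {H : HashCollection} {d r : ℕ → ℕ} (h : H.IsRestrictedUOWHF d r) :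
    H.IsEfficient := h.1

/-- The components of Def. 6.4.19: the range on the domain. [cite: Goldreich2004, Def. 6.4.19] -/
theorem IsRestrictedUOWHF.length_hash {H : HashCollection} {d r : ℕ → ℕ} (h : H.IsRestrictedUOWHF d r)
    {s x : List Bool} (hx : x.length = d s.length) : (H.hash s x).length = r s.length := h.2.1 s x hx

/-- The components of Def. 6.4.19: indices of length `n`. [cite: Goldreich2004, Def. 6.4.19 (1)] -/
theorem IsRestrictedUOWHF.length_index {H : HashCollection} {d r : ℕ → ℕ} (h : H.IsRestrictedUOWHF d r) :
    ∀ᶠ n in atTop, ∀ s ∈ (H.indexPMF n).support, s.length = n := h.2.2.1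

/-- The components of Def. 6.4.19: hardness to form designated collisions inside the domain.
[cite: Goldreich2004, Def. 6.4.19 (3)] -/
theorem IsRestrictedUOWHF.superpolynomialDecay {H : HashCollection} {d r : ℕ → ℕ} (h : H.IsRestrictedUOWHF d r)
    (q : Polynomial ℕ) {A₀ : List Bool → List Bool} (hA₀ : A₀ ∈ FP) {A : RandAlg (List Bool) (List Bool)}
    (hA : IsPPT A id) :
    SuperpolynomialDecay atTop (fun n : ℕ => (n : ℝ)) (H.rtcrProb d (fun n => q.eval n) A₀ A) :=
  h.2.2.2 q A₀ hA₀ A hA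

end HashCollection

end Literature.Computability.Cryptography
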